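import Mathlib.Analysis.Calculus.Deriv.MeanValue
import Mathlib.Analysis.SpecialFunctions.Log.Deriv
import Mathlib.Analysis.SpecialFunctions.ExpDeriv
import Mathlib.Analysis.SpecialFunctions.Pow.Real
import Mathlib.Algebra.BigOperators.Field

/-!
# BalabanUVNodes ∕ node N20 (NE7b) — THERMODYNAMIC INTEGRATION FOR THE INTERPOLATED CLASS FREE ENERGY `F(s) = log Σ_τ A_τ^{1−s} B_τ^{s}`:
# its derivative is the tilted MEAN of the two-run log-increment `h = log B − log A`, its second derivative the tilted VARIANCE, hence
# (i) the midpoint log-convexity defect `Δ = ½log ΣA + ½log ΣB − log Σ√(AB)` (= −log Hellinger affinity) is `≤ ⅛·sup_{s∈[0,1]} Var_{μ_s}(h)`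
# — the crux card `hellinger-free-energy-road`'s FIRST LEMMA `fdef_le_variance`, kernel-checked — and (ii) the two Gibbs–Bogoliubov gaps
# `(log ΣB − log ΣA) − ⟨h⟩_A`, `⟨h⟩_B − (log ΣB − log ΣA)` each lie in `[0, ½·sup Var]`

Cell `pub-ymgap` (HUMAN RULING D-0062 Track A ∕ director-ym R399 (3a) second-wave width seats), WIDTH SEAT `pub-ymgap-dag-n20-w4` (node n20 = NE7b),
generation g2, CLAIM-1 ∕ INTENT-1 (bus 2026-08-28T06:50:11Z).  Key item K3⁷ `SpineGivenEndpointR13SepCoPH` (stmt-QuantumFields-20544; skeleton of record v5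
941dddb108cbaacf, stub 2 `stub_expansion13H`); filed `--kind proof --supports … --as helper`.  COUNT-NEUTRAL.  THEOREMS ONLY (0 `def`, 0 `instance`, 0 `sorry`);
imports Mathlib ONLY; modifies nothing.  FILE 1 of 2 (FILE 2 `…N20HellingerRoadOfVarianceAndResponse` carries the affinity bound `1 − bc ≤ V∕8`, the per-set
class-law TV letter `≤ √V∕2` and the (V)+(R) ⇒ `HybridNE7` transfer through this lineage's p609004 `…N20HybridClassLawCharacterisation`).

WHY.  ym-nodeO idea-3 g10's crux card `Cruxes/SpineGivenEndpointR13SepCoPH/Ideas/hellinger-free-energy-road.md` (2026-08-28T06:33Z) proposes to measure the two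
runs' class laws at a key through the interpolated class free energy `F_K(s,t) = log Σ_τ A_t(τ)^{1−s}B_t(τ)^s`; its kernel `HellingerRoadSketch.lean` checks the
finite-sum inequalities (Cauchy–Schwarz, Le Cam, tensorisation, data processing, Jensen) and marks as «NOT checked here» exactly the CALCULUS: «the variational
identity `Δ = ∫₀¹ G(s)·Var_{μ_s}(h) ds ≤ ⅛ sup_s Var_{μ_s}(h)` and the (s,t) mixed-difference formula» (its P2), naming `fdef_le_variance` «the first UNCHECKED
lemma of the line»; CRIT-1's triage (06:42Z) concurs («the right first unchecked lemma, M — Not run»).  This file supplies that calculus for ONE finite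
exponential family `s ↦ Σ_{τ∈T} A_τ·e^{s·h_τ}` (for `h = log B − log A` and positive weights this is `Σ A^{1−s}B^s`):
* §1 [folklore] DERIVATIVES of the family (finite sums of exponentials): `Z′ = Σ A e^{sh} h`, `(Σ A e^{sh} h)′ = Σ A e^{sh} h²`, ★ `(log Z)′ = ⟨h⟩_{μ_s}`
  (`hasDerivAt_log_interpolatedSum`), ★ `⟨h⟩_{μ_s}′ = Var_{μ_s}(h)` in the form `Σ w h²∕Z − (Σ w h∕Z)²` (`hasDerivAt_interpolatedMean`), the centred form
  `= Σ w (h − ⟨h⟩)²∕Z` and `Var ≥ 0` (`interpolatedVar_eq_sum_sq ∕ _nonneg`).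
* §2 [folklore] TWO LINES OF ONE-VARIABLE CALCULUS for any `f` with `HasDerivAt f f′`, `HasDerivAt f′ f″` and `f″ ≤ V` on `[0,1]`: the second-order upper
  Taylor bound `f y ≤ f x + f′ x (y − x) + (V∕2)(y − x)²` on `[0,1]²` (`le_taylorTwo_of_deriv2_le`, by monotonicity of `u ↦ f u − f x − f′x(u−x) − (V∕2)(u−x)²`
  on `[x,y]` resp. `[y,x]`, slope bound on `f′` from `Convex.image_sub_le_mul_sub_of_deriv_le`), its lower twin from `L ≤ f″`, whence the MIDPOINT DEFECT
  `(f 0 + f 1)∕2 − f(½) ∈ [0, V∕8]` and the ENDPOINT TANGENT GAPS `f 1 − f 0 − f′ 0`, `f′ 1 − (f 1 − f 0) ∈ [0, V∕2]`.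
* §3 AT THE TWO RUNS' CLASS WEIGHTS (`A, B > 0` on `T ≠ ∅`, `h := log B − log A`; endpoints `Z(0) = ΣA`, `Z(1) = ΣB`, midpoint `Z(½) = Σ√(A·B)`):
  ★★ `midpointDefect_classFreeEnergy_le` — the card's `fdef_le_variance` with `fdef` UNFOLDED and its variance hypothesis VERBATIM:
  `∀ s ∈ [0,1], Σ A e^{s h} h²∕Σ A e^{s h} − (Σ A e^{s h} h∕Σ A e^{s h})² ≤ V` ⇒ `(log ΣA + log ΣB)∕2 − log Σ√(A·B) ≤ V∕8` (the Sketch recovers its own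
  statement by `unfold fdef bc`); ★ `gibbsBogoliubov_gap_left ∕ _right` — `0 ≤ (log ΣB − log ΣA) − Σ A h∕ΣA ≤ V∕2` and `0 ≤ Σ B h∕ΣB − (log ΣB − log ΣA) ≤ V∕2`:
  the Sketch's `gibbs_bogoliubov_sandwich` RE-DERIVED from `F″ ≥ 0` together with the quantified half-variance gaps (so the WIDTH `⟨h⟩_B − ⟨h⟩_A ≤ V`, and the
  Target radius at one `K` costs `(R) + V∕2` rather than the card's `(R) + 2·width`).

ADJACENT (cited, not re-typed): the Sketch's §1–§7 (Cruxes drawer, not importable from Theorems∕); dag-n19-w2 g5 CLAIM-1 (06:44:45Z) `…N19AffinityClassIndexLaws`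
(Le Cam ∕ affinity ∕ tensorisation AT the class index — a different object: no `s`-calculus there, none of it here); dag-n20-w1 g5 `…N20BlockCaricatureLawSeparation`
(the λ-statistic of the independent-block caricature); this lineage's p607565 ∕ p609004 (consumer side; used only in FILE 2).  dag-n19-w4 g4's CLAIM-1 of
06:50:45Z on the same calculus is 34 s LATER on the bus (l.30438 vs l.30428) — precedence of record noted in I.≈30504; one declarer per statement.

HONEST FRAMING.  [folklore] one-variable real analysis of finite sums of exponentials (`HasDerivAt` sums, quotient rule, mean-value monotonicity); the variance
bound `V` is a HYPOTHESIS SHAPE — the card's letter (V) at a key is a two-run estimate for d = 4 that is NOT PRINTED (CRIT-1 §5) and NOT proved, produced by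
nobody; NO estimate of the programme is proved; nothing of Bałaban's asserted or instantiated; NE7 ∕ NE7b ∕ NE7c NOT PRINTED as two-run statements for d = 4
([Balaban1987RG1]–[Balaban1989LargeFieldII] bound ONE run; [King1986] is a d ≤ 3 template) and NOT proved; N19 ∕ N20 ∕ N21 NOT discharged; K3⁷ OPEN, v5 STANDS,
not claimed; no summit statement is proved by this seat; counts UNMOVED (typed 28∕28 · discharged 5∕27, A 5∕28).  One finite four-torus programme at fixed ε —
NOT ℝ⁴, NOT infinite volume, NOT OS, NOT a mass gap, NOT the Clay problem (R4 closes the conditional finite-𝕋⁴ rung `BalabanLadder.UV` only).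
Nearest print for the calculus: thermodynamic integration ∕ free-energy perturbation (Tuckerman, Statistical Mechanics 2nd ed. §8.1–8.2) and the Hellinger ∕
Rényi-½ affinity (Ghosal–van der Vaart, App. B) — folklore, re-derived, not cited as facts.  0 `def`; 0 `sorry`; standard axioms; no cite tags.
-/

noncomputable section

namespace Summit.QuantumFields.YangMills.BalabanUVNodes.N20InterpolatedClassFreeEnergy

open Finset Set

variable {ι : Type*}

/-! ## §1 The finite exponential family `s ↦ Σ_{τ∈T} A_τ·e^{s·h_τ}`: first and second logarithmic derivatives [folklore] -/

section Family
variable (T : Finset ι) (A h : ι → ℝ)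

/-- [folklore] `d∕ds Σ_T A·e^{s·h} = Σ_T A·e^{s·h}·h` (finite sum of exponentials). -/
theorem hasDerivAt_interpolatedSum (s : ℝ) :
    HasDerivAt (fun s => ∑ τ ∈ T, A τ * Real.exp (s * h τ)) (∑ τ ∈ T, A τ * Real.exp (s * h τ) * h τ) s := by
  have : HasDerivAt (fun s => ∑ τ ∈ T, A τ * Real.exp (s * h τ))
      (∑ τ ∈ T, A τ * (Real.exp (s * h τ) * h τ)) s :=
    HasDerivAt.fun_sum fun τ _ => ((hasDerivAt_mul_const (h τ)).exp).const_mul (A τ)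
  convert this using 2 with τ
  ring

/-- [folklore] `d∕ds Σ_T A·e^{s·h}·h = Σ_T A·e^{s·h}·h²`. -/
theorem hasDerivAt_interpolatedMoment (s : ℝ) :
    HasDerivAt (fun s => ∑ τ ∈ T, A τ * Real.exp (s * h τ) * h τ) (∑ τ ∈ T, A τ * Real.exp (s * h τ) * h τ ^ 2) s := by
  have : HasDerivAt (fun s => ∑ τ ∈ T, A τ * Real.exp (s * h τ) * h τ)
      (∑ τ ∈ T, A τ * (Real.exp (s * h τ) * h τ) * h τ) s :=
    HasDerivAt.fun_sum fun τ _ => (((hasDerivAt_mul_const (h τ)).exp).const_mul (A τ)).mul_const (h τ)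
  convert this using 2 with τ
  ring

variable {T A}

/-- [folklore] the interpolated partition function `Σ_T A·e^{s·h}` is positive for positive weights on a nonempty class set. -/
theorem interpolatedSum_pos (hT : T.Nonempty) (hA : ∀ τ ∈ T, 0 < A τ) (s : ℝ) :
    0 < ∑ τ ∈ T, A τ * Real.exp (s * h τ) :=
  sum_pos (fun τ hτ => mul_pos (hA τ hτ) (Real.exp_pos _)) hT

/-- **★ FIRST LOGARITHMIC DERIVATIVE = TILTED MEAN** [folklore]: `d∕ds log Σ_T A·e^{s·h} = Σ_T A·e^{s·h}·h ∕ Σ_T A·e^{s·h} = ⟨h⟩_{μ_s}`, `μ_s ∝ A·e^{s·h}`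
(thermodynamic integration: the derivative of the interpolated free energy is the ensemble mean of the increment). -/
theorem hasDerivAt_log_interpolatedSum (hT : T.Nonempty) (hA : ∀ τ ∈ T, 0 < A τ) (s : ℝ) :
    HasDerivAt (fun s => Real.log (∑ τ ∈ T, A τ * Real.exp (s * h τ)))
      ((∑ τ ∈ T, A τ * Real.exp (s * h τ) * h τ) / (∑ τ ∈ T, A τ * Real.exp (s * h τ))) s :=
  (hasDerivAt_interpolatedSum T A h s).log (interpolatedSum_pos h hT hA s).ne'

/-- [arithmetic] `Z₂∕Z − (Z₁∕Z)² = (Z₂·Z − Z₁·Z₁)∕Z²` — the quotient-rule output rearranged. -/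
private theorem mean_deriv_aux {Z Z₁ Z₂ : ℝ} (hZ : Z ≠ 0) :
    Z₂ / Z - (Z₁ / Z) ^ 2 = (Z₂ * Z - Z₁ * Z₁) / Z ^ 2 := by
  field_simp

/-- **★ DERIVATIVE OF THE TILTED MEAN = TILTED VARIANCE** [folklore]: `d∕ds ⟨h⟩_{μ_s} = Σ A e^{sh} h²∕Z − (Σ A e^{sh} h∕Z)² = Var_{μ_s}(h)` (quotient rule) — the
second derivative of the interpolated class free energy, in exactly the shape of the card's variance hypothesis. -/
theorem hasDerivAt_interpolatedMean (hT : T.Nonempty) (hA : ∀ τ ∈ T, 0 < A τ) (s : ℝ) :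
    HasDerivAt (fun s => (∑ τ ∈ T, A τ * Real.exp (s * h τ) * h τ) / (∑ τ ∈ T, A τ * Real.exp (s * h τ)))
      ((∑ τ ∈ T, A τ * Real.exp (s * h τ) * h τ ^ 2) / (∑ τ ∈ T, A τ * Real.exp (s * h τ))
        - ((∑ τ ∈ T, A τ * Real.exp (s * h τ) * h τ) / (∑ τ ∈ T, A τ * Real.exp (s * h τ))) ^ 2) s := by
  have hZ := (interpolatedSum_pos h hT hA s).ne'
  have := (hasDerivAt_interpolatedMoment T A h s).div (hasDerivAt_interpolatedSum T A h s) hZ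
  rw [mean_deriv_aux hZ]
  exact this

/-- [arithmetic] `Z₂∕Z − (Z₁∕Z)² = (Z₂ − 2(Z₁∕Z)Z₁ + (Z₁∕Z)²Z)∕Z` — the centred second moment rearranged. -/
private theorem var_identity_aux {Z Z₁ Z₂ : ℝ} (hZ : Z ≠ 0) :
    Z₂ / Z - (Z₁ / Z) ^ 2 = (Z₂ - 2 * (Z₁ / Z) * Z₁ + (Z₁ / Z) ^ 2 * Z) / Z := by
  field_simp
  ring

/-- **CENTRED FORM OF THE TILTED VARIANCE** [folklore]: `Σ w h²∕Z − (Σ w h∕Z)² = Σ_T w·(h − ⟨h⟩)² ∕ Z` with `w = A·e^{s·h}`, `Z = Σ_T w`. -/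
theorem interpolatedVar_eq_sum_sq (hT : T.Nonempty) (hA : ∀ τ ∈ T, 0 < A τ) (s : ℝ) :
    (∑ τ ∈ T, A τ * Real.exp (s * h τ) * h τ ^ 2) / (∑ τ ∈ T, A τ * Real.exp (s * h τ))
        - ((∑ τ ∈ T, A τ * Real.exp (s * h τ) * h τ) / (∑ τ ∈ T, A τ * Real.exp (s * h τ))) ^ 2
      = (∑ τ ∈ T, A τ * Real.exp (s * h τ) *
          (h τ - (∑ σ ∈ T, A σ * Real.exp (s * h σ) * h σ) / (∑ σ ∈ T, A σ * Real.exp (s * h σ))) ^ 2)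
        / (∑ τ ∈ T, A τ * Real.exp (s * h τ)) := by
  set Z := ∑ τ ∈ T, A τ * Real.exp (s * h τ) with hZdef
  set Z₁ := ∑ τ ∈ T, A τ * Real.exp (s * h τ) * h τ with hZ₁def
  set Z₂ := ∑ τ ∈ T, A τ * Real.exp (s * h τ) * h τ ^ 2 with hZ₂def
  have hZ : Z ≠ 0 := (interpolatedSum_pos h hT hA s).ne'
  have hexp : ∑ τ ∈ T, A τ * Real.exp (s * h τ) * (h τ - Z₁ / Z) ^ 2 = Z₂ - 2 * (Z₁ / Z) * Z₁ + (Z₁ / Z) ^ 2 * Z := by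
    have : ∀ τ ∈ T, A τ * Real.exp (s * h τ) * (h τ - Z₁ / Z) ^ 2 =
        A τ * Real.exp (s * h τ) * h τ ^ 2 - 2 * (Z₁ / Z) * (A τ * Real.exp (s * h τ) * h τ)
          + (Z₁ / Z) ^ 2 * (A τ * Real.exp (s * h τ)) := fun τ _ => by ring
    rw [sum_congr rfl this, sum_add_distrib, sum_sub_distrib, ← mul_sum, ← mul_sum]
  rw [hexp]
  exact var_identity_aux hZ

/-- [folklore] the tilted variance `Σ A e^{sh} h²∕Z − (Σ A e^{sh} h∕Z)²` is nonnegative. -/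
theorem interpolatedVar_nonneg (hT : T.Nonempty) (hA : ∀ τ ∈ T, 0 < A τ) (s : ℝ) :
    0 ≤ (∑ τ ∈ T, A τ * Real.exp (s * h τ) * h τ ^ 2) / (∑ τ ∈ T, A τ * Real.exp (s * h τ))
        - ((∑ τ ∈ T, A τ * Real.exp (s * h τ) * h τ) / (∑ τ ∈ T, A τ * Real.exp (s * h τ))) ^ 2 := by
  rw [interpolatedVar_eq_sum_sq h hT hA s]
  exact div_nonneg (sum_nonneg fun τ hτ => mul_nonneg (mul_nonneg (hA τ hτ).le (Real.exp_pos _).le) (sq_nonneg _))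
    (interpolatedSum_pos h hT hA s).le

end Family


/-! ## §2 Two lines of one-variable calculus: second-order Taylor bounds on `[0,1]` from bounds on `f″` [folklore] -/

/-- **UPPER SECOND-ORDER TAYLOR BOUND ON `[0,1]`** [folklore].  `HasDerivAt f f′`, `HasDerivAt f′ f″` everywhere and `f″ ≤ V` on `[0,1]` ⇒
`f y ≤ f x + f′ x·(y − x) + (V∕2)·(y − x)²` for `x, y ∈ [0,1]` — the slope bound `f′ b − f′ a ≤ V(b − a)` (`Convex.image_sub_le_mul_sub_of_deriv_le`)
makes `u ↦ f u − f x − f′ x (u − x) − (V∕2)(u − x)²` antitone on `[x, y]` (resp. monotone on `[y, x]`), and it vanishes at `u = x`. -/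
theorem le_taylorTwo_of_deriv2_le {f f' f'' : ℝ → ℝ} {V : ℝ}
    (hf : ∀ s, HasDerivAt f (f' s) s) (hf' : ∀ s, HasDerivAt f' (f'' s) s)
    (hV : ∀ s ∈ Icc (0:ℝ) 1, f'' s ≤ V) {x y : ℝ} (hx : x ∈ Icc (0:ℝ) 1) (hy : y ∈ Icc (0:ℝ) 1) :
    f y ≤ f x + f' x * (y - x) + V / 2 * (y - x) ^ 2 := by
  -- the slope bound on `f'` over `[0,1]`
  have hcont' : ContinuousOn f' (Icc (0:ℝ) 1) := fun s _ => (hf' s).continuousAt.continuousWithinAt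
  have hdiff' : DifferentiableOn ℝ f' (interior (Icc (0:ℝ) 1)) := fun s _ => (hf' s).differentiableAt.differentiableWithinAt
  have hslope : ∀ a ∈ Icc (0:ℝ) 1, ∀ b ∈ Icc (0:ℝ) 1, a ≤ b → f' b - f' a ≤ V * (b - a) := by
    intro a ha b hb hab
    refine (convex_Icc 0 1).image_sub_le_mul_sub_of_deriv_le hcont' hdiff' (fun s hs => ?_) a ha b hb hab
    rw [(hf' s).deriv]
    exact hV s (interior_subset hs)
  -- the comparison function `φ u = f u − f x − f' x (u − x) − V/2 (u − x)²`
  have hφd : ∀ u, HasDerivAt (fun u => f u - f x - f' x * (u - x) - V / 2 * (u - x) ^ 2)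
      (f' u - f' x - V * (u - x)) u := by
    intro u
    have h1 : HasDerivAt (fun u => f' x * (u - x)) (f' x * 1) u := ((hasDerivAt_id u).sub_const x).const_mul _
    have h2 : HasDerivAt (fun u => V / 2 * (u - x) ^ 2) (V / 2 * (2 * (u - x) ^ 1 * 1)) u :=
      (((hasDerivAt_id u).sub_const x).pow 2).const_mul _
    have h3 := (((hf u).sub_const (f x)).sub h1).sub h2
    have e : f' u - f' x - V * (u - x) = f' u - f' x * 1 - V / 2 * (2 * (u - x) ^ 1 * 1) := by ring
    rw [e]
    exact h3
  have hφcont : ∀ D : Set ℝ, ContinuousOn (fun u => f u - f x - f' x * (u - x) - V / 2 * (u - x) ^ 2) D :=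
    fun D s _ => (hφd s).continuousAt.continuousWithinAt
  have hφdiff : ∀ D : Set ℝ, DifferentiableOn ℝ (fun u => f u - f x - f' x * (u - x) - V / 2 * (u - x) ^ 2) D :=
    fun D s _ => (hφd s).differentiableAt.differentiableWithinAt
  have goal : (fun u => f u - f x - f' x * (u - x) - V / 2 * (u - x) ^ 2) y ≤ 0 := by
    rcases le_total x y with hxy | hyx
    · -- antitone on `[x, y]`
      have hanti : AntitoneOn (fun u => f u - f x - f' x * (u - x) - V / 2 * (u - x) ^ 2) (Icc x y) := by
        refine antitoneOn_of_deriv_nonpos (convex_Icc x y) (hφcont _) (hφdiff _) fun u hu => ?_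
        rw [interior_Icc] at hu
        rw [(hφd u).deriv]
        have hu' : u ∈ Icc (0:ℝ) 1 := ⟨hx.1.trans hu.1.le, hu.2.le.trans hy.2⟩
        have := hslope x hx u hu' hu.1.le
        linarith
      have := hanti (left_mem_Icc.2 hxy) (right_mem_Icc.2 hxy) hxy
      simp only at this
      linarith
    · -- monotone on `[y, x]`
      have hmono : MonotoneOn (fun u => f u - f x - f' x * (u - x) - V / 2 * (u - x) ^ 2) (Icc y x) := by
        refine monotoneOn_of_deriv_nonneg (convex_Icc y x) (hφcont _) (hφdiff _) fun u hu => ?_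
        rw [interior_Icc] at hu
        rw [(hφd u).deriv]
        have hu' : u ∈ Icc (0:ℝ) 1 := ⟨hy.1.trans hu.1.le, hu.2.le.trans hx.2⟩
        have := hslope u hu' x hx hu.2.le
        linarith
      have := hmono (left_mem_Icc.2 hyx) (right_mem_Icc.2 hyx) hyx
      simp only at this
      linarith
  simp only at goal
  linarith

/-- **LOWER SECOND-ORDER TAYLOR BOUND ON `[0,1]`** [folklore]: `L ≤ f″` on `[0,1]` ⇒ `f x + f′ x·(y − x) + (L∕2)·(y − x)² ≤ f y` (the upper bound applied to `−f`). -/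
theorem taylorTwo_le_of_le_deriv2 {f f' f'' : ℝ → ℝ} {L : ℝ}
    (hf : ∀ s, HasDerivAt f (f' s) s) (hf' : ∀ s, HasDerivAt f' (f'' s) s)
    (hL : ∀ s ∈ Icc (0:ℝ) 1, L ≤ f'' s) {x y : ℝ} (hx : x ∈ Icc (0:ℝ) 1) (hy : y ∈ Icc (0:ℝ) 1) :
    f x + f' x * (y - x) + L / 2 * (y - x) ^ 2 ≤ f y := by
  have := le_taylorTwo_of_deriv2_le (f := fun s => -f s) (f' := fun s => -f' s) (f'' := fun s => -f'' s) (V := -L)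
    (fun s => (hf s).neg) (fun s => (hf' s).neg) (fun s hs => neg_le_neg (hL s hs)) hx hy
  linarith

/-- **MIDPOINT LOG-CONVEXITY DEFECT ≤ V∕8** [folklore]: `f″ ≤ V` on `[0,1]` ⇒ `(f 0 + f 1)∕2 − f(½) ≤ V∕8` — the two upper Taylor bounds from `x = ½` to `y = 0, 1`
(each remainder `≤ (V∕2)·(½)² = V∕8`), averaged.  This is the variational identity `Δ = ∫₀¹ G f″ ≤ ⅛ sup f″` of the card, in inequality form. -/
theorem midpointDefect_le_of_deriv2_le {f f' f'' : ℝ → ℝ} {V : ℝ}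
    (hf : ∀ s, HasDerivAt f (f' s) s) (hf' : ∀ s, HasDerivAt f' (f'' s) s)
    (hV : ∀ s ∈ Icc (0:ℝ) 1, f'' s ≤ V) :
    (f 0 + f 1) / 2 - f (1 / 2) ≤ V / 8 := by
  have hh : (1/2 : ℝ) ∈ Icc (0:ℝ) 1 := ⟨by norm_num, by norm_num⟩
  have h0 := le_taylorTwo_of_deriv2_le hf hf' hV hh (left_mem_Icc.2 zero_le_one)
  have h1 := le_taylorTwo_of_deriv2_le hf hf' hV hh (right_mem_Icc.2 zero_le_one)
  nlinarith [h0, h1]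

/-- **MIDPOINT DEFECT ≥ 0** [folklore]: `0 ≤ f″` on `[0,1]` ⇒ `f(½) ≤ (f 0 + f 1)∕2`. -/
theorem midpointDefect_nonneg_of_deriv2_nonneg {f f' f'' : ℝ → ℝ}
    (hf : ∀ s, HasDerivAt f (f' s) s) (hf' : ∀ s, HasDerivAt f' (f'' s) s)
    (h0 : ∀ s ∈ Icc (0:ℝ) 1, 0 ≤ f'' s) :
    0 ≤ (f 0 + f 1) / 2 - f (1 / 2) := by
  have hh : (1/2 : ℝ) ∈ Icc (0:ℝ) 1 := ⟨by norm_num, by norm_num⟩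
  have ha := taylorTwo_le_of_le_deriv2 hf hf' h0 hh (left_mem_Icc.2 zero_le_one)
  have hb := taylorTwo_le_of_le_deriv2 hf hf' h0 hh (right_mem_Icc.2 zero_le_one)
  nlinarith [ha, hb]

/-- **TANGENT GAP AT `s = 0`** [folklore]: `0 ≤ f″ ≤ V` on `[0,1]` ⇒ `0 ≤ f 1 − f 0 − f′ 0 ≤ V∕2` (Taylor from `x = 0` to `y = 1`, both directions). -/
theorem tangentGap_zero_mem {f f' f'' : ℝ → ℝ} {V : ℝ}
    (hf : ∀ s, HasDerivAt f (f' s) s) (hf' : ∀ s, HasDerivAt f' (f'' s) s)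
    (h0 : ∀ s ∈ Icc (0:ℝ) 1, 0 ≤ f'' s) (hV : ∀ s ∈ Icc (0:ℝ) 1, f'' s ≤ V) :
    0 ≤ f 1 - f 0 - f' 0 ∧ f 1 - f 0 - f' 0 ≤ V / 2 := by
  have ha := taylorTwo_le_of_le_deriv2 hf hf' h0 (left_mem_Icc.2 zero_le_one) (right_mem_Icc.2 zero_le_one)
  have hb := le_taylorTwo_of_deriv2_le hf hf' hV (left_mem_Icc.2 zero_le_one) (right_mem_Icc.2 zero_le_one)
  constructor <;> nlinarith [ha, hb]

/-- **TANGENT GAP AT `s = 1`** [folklore]: `0 ≤ f″ ≤ V` on `[0,1]` ⇒ `0 ≤ f′ 1 − (f 1 − f 0) ≤ V∕2` (Taylor from `x = 1` to `y = 0`, both directions). -/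
theorem tangentGap_one_mem {f f' f'' : ℝ → ℝ} {V : ℝ}
    (hf : ∀ s, HasDerivAt f (f' s) s) (hf' : ∀ s, HasDerivAt f' (f'' s) s)
    (h0 : ∀ s ∈ Icc (0:ℝ) 1, 0 ≤ f'' s) (hV : ∀ s ∈ Icc (0:ℝ) 1, f'' s ≤ V) :
    0 ≤ f' 1 - (f 1 - f 0) ∧ f' 1 - (f 1 - f 0) ≤ V / 2 := by
  have ha := taylorTwo_le_of_le_deriv2 hf hf' h0 (right_mem_Icc.2 zero_le_one) (left_mem_Icc.2 zero_le_one)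
  have hb := le_taylorTwo_of_deriv2_le hf hf' hV (right_mem_Icc.2 zero_le_one) (left_mem_Icc.2 zero_le_one)
  constructor <;> nlinarith [ha, hb]


/-! ## §3 At the two runs' class weights: the card's first lemma and the Gibbs–Bogoliubov half-variance gaps [folklore] -/

section ClassWeights
variable {T : Finset ι} {A B : ι → ℝ}

/-- endpoint `s = 1`, termwise [folklore]: `A·e^{1·(log B − log A)} = B` for `A, B > 0` — so `Σ A e^{s h}` interpolates `ΣA` (s = 0) and `ΣB` (s = 1). -/
theorem mul_exp_one_mul_logRatio (hA : ∀ τ ∈ T, 0 < A τ) (hB : ∀ τ ∈ T, 0 < B τ) :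
    ∀ τ ∈ T, A τ * Real.exp (1 * (Real.log (B τ) - Real.log (A τ))) = B τ := by
  intro τ hτ
  rw [one_mul, Real.exp_sub, Real.exp_log (hB τ hτ), Real.exp_log (hA τ hτ)]
  field_simp [(hA τ hτ).ne']

/-- midpoint `s = ½`, termwise [folklore]: `A·e^{½·(log B − log A)} = √(A·B)` for `A, B > 0` — the geometric mean, whence `Z(½)` is the Bhattacharyya sum. -/
theorem mul_exp_half_mul_logRatio (hA : ∀ τ ∈ T, 0 < A τ) (hB : ∀ τ ∈ T, 0 < B τ) :
    ∀ τ ∈ T, A τ * Real.exp (1 / 2 * (Real.log (B τ) - Real.log (A τ))) = Real.sqrt (A τ * B τ) := by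
  intro τ hτ
  have hE : Real.exp (1 / 2 * (Real.log (B τ) - Real.log (A τ))) * Real.exp (1 / 2 * (Real.log (B τ) - Real.log (A τ)))
      = B τ / A τ := by
    rw [← Real.exp_add, ← two_mul, ← mul_assoc, show (2:ℝ) * (1/2) = 1 by norm_num, one_mul, Real.exp_sub,
      Real.exp_log (hB τ hτ), Real.exp_log (hA τ hτ)]
  have hpos : 0 ≤ A τ * Real.exp (1 / 2 * (Real.log (B τ) - Real.log (A τ))) := (mul_pos (hA τ hτ) (Real.exp_pos _)).le
  symm
  rw [Real.sqrt_eq_iff_mul_self_eq (mul_pos (hA τ hτ) (hB τ hτ)).le hpos]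
  symm
  calc A τ * Real.exp (1 / 2 * (Real.log (B τ) - Real.log (A τ))) * (A τ * Real.exp (1 / 2 * (Real.log (B τ) - Real.log (A τ))))
      = A τ * A τ * (Real.exp (1 / 2 * (Real.log (B τ) - Real.log (A τ))) * Real.exp (1 / 2 * (Real.log (B τ) - Real.log (A τ)))) := by ring
    _ = A τ * B τ := by rw [hE]; field_simp [(hA τ hτ).ne']

/-- endpoint `s = 0`: `Σ_T A·e^{0·h} = Σ_T A`. -/
theorem sum_mul_exp_zero_mul (h : ι → ℝ) : ∑ τ ∈ T, A τ * Real.exp (0 * h τ) = ∑ τ ∈ T, A τ := by simp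
/-- endpoint `s = 0`, first moment: `Σ_T A·e^{0·h}·h = Σ_T A·h`. -/
theorem sum_mul_exp_zero_mul_mul (h : ι → ℝ) : ∑ τ ∈ T, A τ * Real.exp (0 * h τ) * h τ = ∑ τ ∈ T, A τ * h τ := by simp

/-- endpoint `s = 1`: `Σ_T A·e^{log B − log A} = Σ_T B` for positive weights. -/
theorem sum_mul_exp_one_mul (hA : ∀ τ ∈ T, 0 < A τ) (hB : ∀ τ ∈ T, 0 < B τ) :
    ∑ τ ∈ T, A τ * Real.exp (1 * (Real.log (B τ) - Real.log (A τ))) = ∑ τ ∈ T, B τ :=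
  sum_congr rfl (mul_exp_one_mul_logRatio hA hB)

/-- endpoint `s = 1`, first moment: `Σ_T A·e^{log B − log A}·(log B − log A) = Σ_T B·(log B − log A)`. -/
theorem sum_mul_exp_one_mul_mul (hA : ∀ τ ∈ T, 0 < A τ) (hB : ∀ τ ∈ T, 0 < B τ) :
    ∑ τ ∈ T, A τ * Real.exp (1 * (Real.log (B τ) - Real.log (A τ))) * (Real.log (B τ) - Real.log (A τ))
      = ∑ τ ∈ T, B τ * (Real.log (B τ) - Real.log (A τ)) :=
  sum_congr rfl fun τ hτ => by rw [mul_exp_one_mul_logRatio hA hB τ hτ]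

/-- midpoint `s = ½`: `Σ_T A·e^{(log B − log A)∕2} = Σ_T √(A·B)` — the (unnormalised) Hellinger affinity ∕ Bhattacharyya sum. -/
theorem sum_mul_exp_half_mul (hA : ∀ τ ∈ T, 0 < A τ) (hB : ∀ τ ∈ T, 0 < B τ) :
    ∑ τ ∈ T, A τ * Real.exp (1 / 2 * (Real.log (B τ) - Real.log (A τ))) = ∑ τ ∈ T, Real.sqrt (A τ * B τ) :=
  sum_congr rfl (mul_exp_half_mul_logRatio hA hB)

/-- **★★ THE CARD'S FIRST LEMMA `fdef_le_variance`, KERNEL FORM (`fdef`, `bc` UNFOLDED)** [folklore].  For positive class weights `A, B` on a nonempty finite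
class set `T` and the two-run log-increment `h = log B − log A`: if the tilted variance is bounded on the unit interval,
`∀ s ∈ [0,1], Σ_T A e^{s h} h² ∕ Σ_T A e^{s h} − (Σ_T A e^{s h} h ∕ Σ_T A e^{s h})² ≤ V` (the card's hypothesis `hV`, symbol for symbol), then the midpoint
log-convexity defect of the interpolated class free energy — minus the log of the Hellinger affinity of the normalised class laws — obeys
`(log Σ_T A + log Σ_T B)∕2 − log Σ_T √(A·B) ≤ V∕8`.  (§2's midpoint bound for `F = log Σ A e^{s h}` with `F″ = Var_{μ_s}(h)` from §1, endpoints and midpoint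
identified by `sum_mul_exp_zero_mul ∕ _one_mul ∕ _half_mul`.)  The Sketch's `fdef T A B ≤ V ∕ 8` is this statement after `unfold fdef bc`. -/
theorem midpointDefect_classFreeEnergy_le (hT : T.Nonempty) (hA : ∀ τ ∈ T, 0 < A τ) (hB : ∀ τ ∈ T, 0 < B τ) {V : ℝ}
    (hV : ∀ s ∈ Set.Icc (0:ℝ) 1,
      (∑ τ ∈ T, A τ * Real.exp (s * (Real.log (B τ) - Real.log (A τ))) * (Real.log (B τ) - Real.log (A τ)) ^ 2)
          / (∑ τ ∈ T, A τ * Real.exp (s * (Real.log (B τ) - Real.log (A τ))))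
        - ((∑ τ ∈ T, A τ * Real.exp (s * (Real.log (B τ) - Real.log (A τ))) * (Real.log (B τ) - Real.log (A τ)))
          / (∑ τ ∈ T, A τ * Real.exp (s * (Real.log (B τ) - Real.log (A τ))))) ^ 2 ≤ V) :
    (Real.log (∑ τ ∈ T, A τ) + Real.log (∑ τ ∈ T, B τ)) / 2 - Real.log (∑ τ ∈ T, Real.sqrt (A τ * B τ)) ≤ V / 8 := by
  have h := midpointDefect_le_of_deriv2_le
    (hasDerivAt_log_interpolatedSum (fun τ => Real.log (B τ) - Real.log (A τ)) hT hA)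
    (hasDerivAt_interpolatedMean (fun τ => Real.log (B τ) - Real.log (A τ)) hT hA) hV
  rwa [sum_mul_exp_zero_mul, sum_mul_exp_one_mul hA hB, sum_mul_exp_half_mul hA hB] at h

/-- **LOG-CONVEXITY AT THE MIDPOINT, BY CALCULUS** [folklore]: `0 ≤ (log ΣA + log ΣB)∕2 − log Σ√(A·B)` (the Sketch's `fdef_nonneg` ∕ Cauchy–Schwarz, here from `F″ = Var ≥ 0`). -/
theorem midpointDefect_classFreeEnergy_nonneg (hT : T.Nonempty) (hA : ∀ τ ∈ T, 0 < A τ) (hB : ∀ τ ∈ T, 0 < B τ) :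
    0 ≤ (Real.log (∑ τ ∈ T, A τ) + Real.log (∑ τ ∈ T, B τ)) / 2 - Real.log (∑ τ ∈ T, Real.sqrt (A τ * B τ)) := by
  have h := midpointDefect_nonneg_of_deriv2_nonneg
    (hasDerivAt_log_interpolatedSum (fun τ => Real.log (B τ) - Real.log (A τ)) hT hA)
    (hasDerivAt_interpolatedMean (fun τ => Real.log (B τ) - Real.log (A τ)) hT hA)
    (fun s _ => interpolatedVar_nonneg (fun τ => Real.log (B τ) - Real.log (A τ)) hT hA s)
  rwa [sum_mul_exp_zero_mul, sum_mul_exp_one_mul hA hB, sum_mul_exp_half_mul hA hB] at h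

/-- **★ GIBBS–BOGOLIUBOV, RUN-A SIDE, WITH THE HALF-VARIANCE GAP** [folklore].  Under the card's variance hypothesis on `[0,1]`:
`0 ≤ (log Σ_T B − log Σ_T A) − Σ_T A·h ∕ Σ_T A ≤ V∕2`, `h = log B − log A` — the lower Gibbs–Bogoliubov bound `⟨h⟩_A ≤ log ΣB − log ΣA` (the Sketch's
`mean_logRatio_le_log_sub_log`, re-derived from `F″ ≥ 0`) together with its QUANTIFIED slack (tangent gap at `s = 0`, `≤ ½·sup Var`).  At one `K` this is the
run-A half of «target constant = run-A mean increment up to half a variance». -/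
theorem gibbsBogoliubov_gap_left (hT : T.Nonempty) (hA : ∀ τ ∈ T, 0 < A τ) (hB : ∀ τ ∈ T, 0 < B τ) {V : ℝ}
    (hV : ∀ s ∈ Set.Icc (0:ℝ) 1,
      (∑ τ ∈ T, A τ * Real.exp (s * (Real.log (B τ) - Real.log (A τ))) * (Real.log (B τ) - Real.log (A τ)) ^ 2)
          / (∑ τ ∈ T, A τ * Real.exp (s * (Real.log (B τ) - Real.log (A τ))))
        - ((∑ τ ∈ T, A τ * Real.exp (s * (Real.log (B τ) - Real.log (A τ))) * (Real.log (B τ) - Real.log (A τ)))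
          / (∑ τ ∈ T, A τ * Real.exp (s * (Real.log (B τ) - Real.log (A τ))))) ^ 2 ≤ V) :
    0 ≤ Real.log (∑ τ ∈ T, B τ) - Real.log (∑ τ ∈ T, A τ)
        - (∑ τ ∈ T, A τ * (Real.log (B τ) - Real.log (A τ))) / (∑ τ ∈ T, A τ) ∧
      Real.log (∑ τ ∈ T, B τ) - Real.log (∑ τ ∈ T, A τ)
        - (∑ τ ∈ T, A τ * (Real.log (B τ) - Real.log (A τ))) / (∑ τ ∈ T, A τ) ≤ V / 2 := by
  have h := tangentGap_zero_mem
    (hasDerivAt_log_interpolatedSum (fun τ => Real.log (B τ) - Real.log (A τ)) hT hA)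
    (hasDerivAt_interpolatedMean (fun τ => Real.log (B τ) - Real.log (A τ)) hT hA)
    (fun s _ => interpolatedVar_nonneg (fun τ => Real.log (B τ) - Real.log (A τ)) hT hA s) hV
  rwa [sum_mul_exp_zero_mul, sum_mul_exp_zero_mul_mul, sum_mul_exp_one_mul hA hB] at h

/-- **★ GIBBS–BOGOLIUBOV, RUN-B SIDE, WITH THE HALF-VARIANCE GAP** [folklore].  Under the same hypothesis:
`0 ≤ Σ_T B·h ∕ Σ_T B − (log Σ_T B − log Σ_T A) ≤ V∕2` — the upper Gibbs–Bogoliubov bound with its quantified slack (tangent gap at `s = 1`); adding the two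
gaps bounds the WIDTH `⟨h⟩_B − ⟨h⟩_A = ∫₀¹ Var_{μ_s}(h) ds` by `V`. -/
theorem gibbsBogoliubov_gap_right (hT : T.Nonempty) (hA : ∀ τ ∈ T, 0 < A τ) (hB : ∀ τ ∈ T, 0 < B τ) {V : ℝ}
    (hV : ∀ s ∈ Set.Icc (0:ℝ) 1,
      (∑ τ ∈ T, A τ * Real.exp (s * (Real.log (B τ) - Real.log (A τ))) * (Real.log (B τ) - Real.log (A τ)) ^ 2)
          / (∑ τ ∈ T, A τ * Real.exp (s * (Real.log (B τ) - Real.log (A τ))))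
        - ((∑ τ ∈ T, A τ * Real.exp (s * (Real.log (B τ) - Real.log (A τ))) * (Real.log (B τ) - Real.log (A τ)))
          / (∑ τ ∈ T, A τ * Real.exp (s * (Real.log (B τ) - Real.log (A τ))))) ^ 2 ≤ V) :
    0 ≤ (∑ τ ∈ T, B τ * (Real.log (B τ) - Real.log (A τ))) / (∑ τ ∈ T, B τ)
        - (Real.log (∑ τ ∈ T, B τ) - Real.log (∑ τ ∈ T, A τ)) ∧
      (∑ τ ∈ T, B τ * (Real.log (B τ) - Real.log (A τ))) / (∑ τ ∈ T, B τ)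
        - (Real.log (∑ τ ∈ T, B τ) - Real.log (∑ τ ∈ T, A τ)) ≤ V / 2 := by
  have h := tangentGap_one_mem
    (hasDerivAt_log_interpolatedSum (fun τ => Real.log (B τ) - Real.log (A τ)) hT hA)
    (hasDerivAt_interpolatedMean (fun τ => Real.log (B τ) - Real.log (A τ)) hT hA)
    (fun s _ => interpolatedVar_nonneg (fun τ => Real.log (B τ) - Real.log (A τ)) hT hA s) hV
  rwa [sum_mul_exp_zero_mul, sum_mul_exp_one_mul hA hB, sum_mul_exp_one_mul_mul hA hB] at h

end ClassWeights


end Summit.QuantumFields.YangMills.BalabanUVNodes.N20InterpolatedClassFreeEnergy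

end
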